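import Mathlib.GroupTheory.SpecificGroups.Cyclic
import Mathlib.NumberTheory.Padics.PadicVal.Basic
import Mathlib.Algebra.Order.BigOperators.Group.Finset
import Mathlib.Tactic.Ring
import HarnessLib

/-!
# McCallum 1991, Lemma 5.3 / Gross 1991, Prop. 8.1 modulo `p^M`: eigen-parts of `E_{p^M}` and
# annihilators under an alternating pairing

`Proofs` file (theorems only: no definition, no named fact) in topic
`NumberTheory/EllipticCurves`, written for the named fact
`Literature.NumberTheory.EllipticCurves.Kolyvagin1990_sha_primary_finite N W K`
(`HeegnerPointsKolyvaginProofs`; Gross 1991, Thm. 1.3 (2), `p`-primary part), whose tree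
reduction (`KolyvaginDescent.Kolyvagin1990_sha_primary_finite_of_leavesM_of_thmA`,
`HeegnerPointsKolyvaginPrimaryLeavesProofs`) asks, as its leaf **(B)**, for McCallum's
Lemma 5.3 with Prop. 2.2 at every level `p^M` — W. G. McCallum, *Kolyvagin's work on
Shafarevich–Tate groups*, LMS Lecture Note Ser. 153 (1991), §5 (PDF p. 284 of the held volume
`book:editornd-l-functions-arithmetic`): the Tate pairing gives a perfect duality between the
cyclic groups `(E(K_λ)/p^M E(K_λ))^±` and `H¹(K_λ, E_{p^M})^±` of order `p^M`, so that a class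
`d` ramified at `λ` of order `> p^a` in `H¹(K_λ, E)` kills `p^{M-1-a} s_λ` for every Selmer
eigenclass `s` pairing trivially with it — the level-`p^M` form of Gross 1991, Prop. 8.1
(PDF p. 226: *"all eigenspaces have dimension 1"*, and (2) *"if `d_λ ≠ 0` … and
`⟨s_λ, d_λ⟩ = 0`, then `s_λ ≡ 0`"*).

This file is the **pure algebra** of that statement, for an abelian group `T` killed by `p^M`
(to be `E_{p^M} = E(K̄)[p^M]`, of order `p^{2M}` with `#T[p] = p²`), an additive involution
`ι` of `T` (complex conjugation, `p` odd) and a biadditive alternating left-non-degenerate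
pairing `e` on `T` (the Weil pairing `e_{p^M}`, through Kolyvagin's formula (7.6)); companion of
the level-`p` files `HeegnerPointsKolyvaginProp81Proofs` (`KolyvaginEigen.*`) and
`HeegnerPointsKolyvaginProp82Proofs` (`KolyvaginReciprocity.*`):

* `KolyvaginEigenPow.two_mul_half`, `eq_zero_of_two_nsmul_eq_zero`,
  `exists_eigen_add_eigen`, `exists_eigen_add_eigen_mem`, `eq_zero_of_eigen_of_eigen_neg` — for
  `p` odd, `2` is invertible modulo `p^M`, so `T = T⁺ ⊕ T⁻` for the involution `ι` (Gross §5
  (5.1) at level `p^M`);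
* `KolyvaginEigenPow.card_eq_card_mul_card` — `#S = #S⁺ · #S⁻` for every `ι`-stable subgroup
  `S` (so for `T` and for `T[p]`);
* `KolyvaginEigenPow.card_filter_pow_nsmul_le`, `isAddCyclic_of_card_torsion_le` — **a finite
  abelian group killed by `p^M` whose `p`-torsion has at most `p` elements is cyclic**
  (`#G[pʲ] ≤ pʲ` by induction, then Mathlib's `isAddCyclic_of_card_nsmul_eq_zero_le`); with the
  two previous items: *"all eigenspaces are cyclic"* (of order `p^M` when `#T = p^{2M}`,
  `#T[p] = p²` and both signs occur on `T[p]`) — McCallum's *"cyclic groups … of order `p^M`"*,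
  Gross's Prop. 8.1 (1);
* `KolyvaginEigenPow.pairing_zsmul_left`, `addOrderOf_pairing_eq` — if `T = ℤu + ℤw` with
  `u` of order `p^M`, a left-non-degenerate alternating `e` has `e u w` of order exactly `p^M`
  (perfectness);
* `KolyvaginEigenPow.exists_eigen_generators` — **both eigen-parts of `T` are cyclic of order
  `p^M`** when `#T = p^{2M}`, `#T[p] = p²` and `ι` has non-zero `p`-torsion eigenvectors of both
  signs: generators `u` of `T⁺`, `w` of `T⁻`, `T = ℤu + ℤw` (McCallum Lemma 5.3: *"cyclic groups
  of order `p^M`"*); `pow_pred_nsmul_ne_zero`, `eq_pow_of_mul_eq_pow_two_mul` (arithmetic);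
* `KolyvaginEigenPow.pow_nsmul_eq_zero_of_pairing_eq_zero` (**main**) — McCallum's Lemma 5.3
  as used by the descent: for `x ∈ ℤu`, `y₀ ∈ ℤw` with `e u w` of order `p^M`, if
  `p^a y₀ ≠ 0` and `e x y₀ = 0` then `p^{M-1-a} x = 0` (valuations: `p^M ∣ αγ` and
  `p^M ∤ p^a γ` give `p^{a+1} ∣ α`).

No named fact is introduced; axioms are the standard three.

## References

* [McCallumLMS1991] W. G. McCallum, *Kolyvagin's work on Shafarevich–Tate groups*, LMS Lecture
  Note Ser. 153 (1991), 295–316: §5, Lemma 5.3 (held, PDF p. 284).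
* [GrossLMS1991] B. H. Gross, *Kolyvagin's work on modular elliptic curves*, same volume: §8,
  Prop. 8.1 (held, PDF p. 226).
-/

open scoped Classical
open Finset

namespace Literature.NumberTheory.EllipticCurves

namespace KolyvaginEigenPow

variable {T : Type*} [AddCommGroup T] {p M : ℕ}

/-! ## `2` is invertible modulo `p^M` (`p` odd): eigen-decomposition for an involution -/

/-- For `p` odd, `2 · ((p^M + 1)/2) = p^M + 1`. [folklore] -/
theorem two_mul_half (hp : p.Prime) (hp2 : p ≠ 2) : 2 * ((p ^ M + 1) / 2) = p ^ M + 1 :=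
  Nat.two_mul_div_two_of_even ((hp.odd_of_ne_two hp2).pow.add_one)

/-- In an abelian group killed by `p^M` (`p` odd), `2 • y = 0` forces `y = 0`
(`y = (p^M + 1) y = ((p^M+1)/2) (2 y)`). [folklore] -/
theorem eq_zero_of_two_nsmul_eq_zero (hp : p.Prime) (hp2 : p ≠ 2) (hT : ∀ t : T, p ^ M • t = 0)
    {y : T} (h2 : 2 • y = 0) : y = 0 := by
  have h1 : (p ^ M + 1) • y = y := by rw [add_nsmul, hT, one_nsmul, zero_add]
  rw [← h1, ← two_mul_half hp hp2, mul_comm, ← smul_smul, h2, smul_zero]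

/-- **Eigen-decomposition** (`p` odd): every `x` is `a + b` with `ι a = a`, `ι b = -b`, for an
additive involution `ι` of a group killed by `p^M` (`a = h(x + ιx)`, `b = h(x - ιx)`,
`2h ≡ 1`). Gross 1991, §5 (5.1), at level `p^M`. [cite: GrossLMS1991, §5 (5.1)] -/
theorem exists_eigen_add_eigen (hp : p.Prime) (hp2 : p ≠ 2) (hT : ∀ t : T, p ^ M • t = 0)
    (ι : T →+ T) (hι : ∀ x, ι (ι x) = x) (x : T) :
    ∃ a b : T, ι a = a ∧ ι b = -b ∧ x = a + b := by
  set h := (p ^ M + 1) / 2 with hh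
  refine ⟨h • (x + ι x), h • (x - ι x), ?_, ?_, ?_⟩
  · rw [map_nsmul, map_add, hι, add_comm]
  · rw [map_nsmul, map_sub, hι, ← neg_sub, smul_neg]
  · rw [← smul_add, add_add_sub_cancel, ← two_nsmul, smul_smul, mul_comm, hh, two_mul_half hp hp2,
      add_nsmul, hT, one_nsmul, zero_add]

/-- Additionally: if `x` lies in an `ι`-stable subgroup `S`, so do its two components.
[folklore] -/
theorem exists_eigen_add_eigen_mem (hp : p.Prime) (hp2 : p ≠ 2) (hT : ∀ t : T, p ^ M • t = 0)
    (ι : T →+ T) (hι : ∀ x, ι (ι x) = x) {S : AddSubgroup T} (hS : ∀ x ∈ S, ι x ∈ S)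
    {x : T} (hx : x ∈ S) :
    ∃ a b : T, (a ∈ S ∧ ι a = a) ∧ (b ∈ S ∧ ι b = -b) ∧ x = a + b := by
  set h := (p ^ M + 1) / 2 with hh
  refine ⟨h • (x + ι x), h • (x - ι x), ⟨?_, ?_⟩, ⟨?_, ?_⟩, ?_⟩
  · exact S.nsmul_mem (S.add_mem hx (hS x hx)) h
  · rw [map_nsmul, map_add, hι, add_comm]
  · exact S.nsmul_mem (S.sub_mem hx (hS x hx)) h
  · rw [map_nsmul, map_sub, hι, ← neg_sub, smul_neg]
  · rw [← smul_add, add_add_sub_cancel, ← two_nsmul, smul_smul, mul_comm, hh, two_mul_half hp hp2,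
      add_nsmul, hT, one_nsmul, zero_add]

/-- **Opposite eigenvectors meet in `0`** (`p` odd): `ι y = ν y` and `ι y = -(ν y)` (`ν = ±1`)
force `y = 0`. Gross 1991, end of the proof of Prop. 8.1: *"Since `p` is odd"*.
[cite: GrossLMS1991, Prop. 8.1 (2) (proof)] -/
theorem eq_zero_of_eigen_of_eigen_neg (hp : p.Prime) (hp2 : p ≠ 2) (hT : ∀ t : T, p ^ M • t = 0)
    (ι : T →+ T) {ν : ℤ} (hν : ν = 1 ∨ ν = -1) {y : T} (h₁ : ι y = ν • y)
    (h₂ : ι y = -(ν • y)) : y = 0 := by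
  have h2 : 2 • (ν • y) = 0 := by
    rw [two_nsmul]
    nth_rewrite 1 [← h₁]
    rw [h₂, neg_add_cancel]
  have hνν : ν * ν = 1 := by rcases hν with rfl | rfl <;> norm_num
  have h3 : y = ν • (ν • y) := by rw [smul_smul, hνν, one_smul]
  rw [h3, eq_zero_of_two_nsmul_eq_zero hp hp2 hT h2, smul_zero]

/-! ## `#S = #S⁺ · #S⁻` for an `ι`-stable subgroup -/

/-- **An `ι`-stable subgroup is the direct sum of its eigen-parts**: `#S = #S⁺ · #S⁻`
(bijection `(a, b) ↦ a + b`; injective because opposite eigenvectors meet in `0`, surjective by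
`exists_eigen_add_eigen_mem`). Gross 1991, §5 (5.1) / Prop. 8.1 (1) (dimension count).
[cite: GrossLMS1991, §5 (5.1)] -/
theorem card_eq_card_mul_card (hp : p.Prime) (hp2 : p ≠ 2) (hT : ∀ t : T, p ^ M • t = 0)
    (ι : T →+ T) (hι : ∀ x, ι (ι x) = x) (S : AddSubgroup T) (hS : ∀ x ∈ S, ι x ∈ S) :
    Nat.card S = Nat.card {x : T // x ∈ S ∧ ι x = x} * Nat.card {x : T // x ∈ S ∧ ι x = -x} := by
  rw [← Nat.card_prod]
  symm
  refine Nat.card_eq_of_bijective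
    (fun ab : {x : T // x ∈ S ∧ ι x = x} × {x : T // x ∈ S ∧ ι x = -x} ↦
      (⟨ab.1.1 + ab.2.1, S.add_mem ab.1.2.1 ab.2.2.1⟩ : S)) ⟨?_, ?_⟩
  · rintro ⟨⟨a, ha⟩, ⟨b, hb⟩⟩ ⟨⟨a', ha'⟩, ⟨b', hb'⟩⟩ h
    have h' : a + b = a' + b' := congrArg Subtype.val h
    -- `a - a' = b' - b` is a `+1` and a `-1` eigenvector, hence `0`
    have hd : a - a' = b' - b := sub_eq_sub_iff_add_eq_add.mpr (by rw [h', add_comm])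
    have hι1 : ι (a - a') = (1 : ℤ) • (a - a') := by rw [map_sub, ha.2, ha'.2, one_smul]
    have hι2 : ι (a - a') = -((1 : ℤ) • (a - a')) := by
      rw [one_smul, hd, map_sub, hb'.2, hb.2, neg_sub_neg, neg_sub]
    have h0 := eq_zero_of_eigen_of_eigen_neg hp hp2 hT ι (Or.inl rfl) hι1 hι2
    have haa : a = a' := sub_eq_zero.mp h0
    subst haa
    have hbb : b = b' := add_left_cancel h'
    subst hbb
    rfl
  · rintro ⟨x, hx⟩
    obtain ⟨a, b, ha, hb, hab⟩ := exists_eigen_add_eigen_mem hp hp2 hT ι hι hS hx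
    exact ⟨(⟨a, ha⟩, ⟨b, hb⟩), Subtype.ext hab.symm⟩

/-! ## A finite abelian `p^M`-torsion group with `#G[p] ≤ p` is cyclic -/

/-- `#{g | pʲ g = 0} ≤ pʲ` when `#{g | p g = 0} ≤ p` (induction on `j`: multiplication by `p` maps
`G[p^{j+1}]` to `G[pʲ]` with fibres translates of subsets of `G[p]`). [folklore] -/
theorem card_filter_pow_nsmul_le {G : Type*} [AddCommGroup G] [Fintype G] [DecidableEq G]
    (hGp : (Finset.univ.filter fun g : G ↦ p • g = 0).card ≤ p) (j : ℕ) :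
    (Finset.univ.filter fun g : G ↦ p ^ j • g = 0).card ≤ p ^ j := by
  induction j with
  | zero =>
    rw [pow_zero]
    have h1 : (Finset.univ.filter fun g : G ↦ (1 : ℕ) • g = 0) = {0} := by
      ext g
      simp
    rw [h1, Finset.card_singleton]
  | succ j ih =>
    set s := Finset.univ.filter fun g : G ↦ p ^ (j + 1) • g = 0 with hs
    set t := Finset.univ.filter fun g : G ↦ p ^ j • g = 0 with ht
    have hmaps : ∀ g ∈ s, p • g ∈ t := by
      intro g hg
      simp only [hs, ht, Finset.mem_filter, Finset.mem_univ, true_and] at hg ⊢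
      rw [smul_smul, ← pow_succ, hg]
    have hfib : ∀ b ∈ t, (s.filter fun g ↦ p • g = b).card ≤ p := by
      intro b _
      by_cases hne : (s.filter fun g ↦ p • g = b).Nonempty
      · obtain ⟨g₀, hg₀⟩ := hne
        have hg₀' : p • g₀ = b := (Finset.mem_filter.mp hg₀).2
        calc (s.filter fun g ↦ p • g = b).card
            ≤ ((Finset.univ.filter fun g : G ↦ p • g = 0).image fun z ↦ g₀ + z).card := by
              apply Finset.card_le_card
              intro g hg
              rw [Finset.mem_image]
              refine ⟨g - g₀, ?_, add_sub_cancel g₀ g⟩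
              simp only [Finset.mem_filter, Finset.mem_univ, true_and]
              rw [smul_sub, (Finset.mem_filter.mp hg).2, hg₀', sub_self]
          _ ≤ (Finset.univ.filter fun g : G ↦ p • g = 0).card := Finset.card_image_le
          _ ≤ p := hGp
      · rw [Finset.not_nonempty_iff_eq_empty.mp hne, Finset.card_empty]
        exact Nat.zero_le _
    calc s.card ≤ p * t.card := Finset.card_le_mul_card_image_of_maps_to hmaps p hfib
      _ ≤ p * p ^ j := Nat.mul_le_mul_left p ih
      _ = p ^ (j + 1) := by ring

/-- **A finite abelian group killed by `p^M` whose `p`-torsion has at most `p` elements is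
cyclic** (equivalently: a finite abelian `p`-group of `p`-rank `1` is cyclic). For `n > 0` the
`n`-torsion is the `gcd(n, p^M) = pʲ`-torsion, of order `≤ pʲ ≤ n` (`card_filter_pow_nsmul_le`),
so Mathlib's `isAddCyclic_of_card_nsmul_eq_zero_le` applies. This is *"the eigenspaces … are
cyclic groups"* of McCallum 1991, Lemma 5.3 / Gross 1991, Prop. 8.1 (1) at level `p^M`.
[cite: McCallumLMS1991, §5 Lemma 5.3] -/
theorem isAddCyclic_of_card_torsion_le {G : Type*} [AddCommGroup G] [Finite G] (hp : p.Prime)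
    (hG : ∀ g : G, p ^ M • g = 0) (hGp : Nat.card {g : G // p • g = 0} ≤ p) : IsAddCyclic G := by
  classical
  letI := Fintype.ofFinite G
  have hGp' : (Finset.univ.filter fun g : G ↦ p • g = 0).card ≤ p := by
    rwa [Nat.card_eq_fintype_card, Fintype.card_subtype] at hGp
  apply isAddCyclic_of_card_nsmul_eq_zero_le
  intro n hn
  obtain ⟨j, -, hj⟩ := (Nat.dvd_prime_pow hp).mp (Nat.gcd_dvd_right n (p ^ M))
  have hdvd : p ^ j ∣ n := hj ▸ Nat.gcd_dvd_left n (p ^ M)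
  calc (Finset.univ.filter fun g : G ↦ n • g = 0).card
      ≤ (Finset.univ.filter fun g : G ↦ p ^ j • g = 0).card := by
        apply Finset.card_le_card
        intro g hg
        simp only [Finset.mem_filter, Finset.mem_univ, true_and] at hg ⊢
        rw [← hj]
        have key : ((Nat.gcd n (p ^ M) : ℕ) : ℤ) • g = 0 := by
          rw [Nat.gcd_eq_gcd_ab n (p ^ M), add_smul, mul_comm (n : ℤ),
            mul_comm ((p ^ M : ℕ) : ℤ), mul_smul, mul_smul, natCast_zsmul, natCast_zsmul, hg,
            hG g, smul_zero, smul_zero, add_zero]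
        rwa [natCast_zsmul] at key
    _ ≤ p ^ j := card_filter_pow_nsmul_le hGp' j
    _ ≤ n := Nat.le_of_dvd hn hdvd

/-! ## Perfectness of an alternating non-degenerate pairing on `ℤu + ℤw`, and the descent -/

/-- `e (β • s) t = β • e s t` for a biadditive `e`. [folklore] -/
theorem pairing_zsmul_left {A : Type*} [AddCommGroup A] (e : T →+ T →+ A) (β : ℤ) (s t : T) :
    e (β • s) t = β • e s t := by
  rw [← AddMonoidHom.flip_apply e (β • s) t, map_zsmul, AddMonoidHom.flip_apply]

/-- **Perfectness**: if `T = ℤu + ℤw`, `u` has order `≥ p^M` (`p^{M-1} u ≠ 0`), `T` is killed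
by `p^M`, and `e` is alternating and left-non-degenerate, then `e u w` has order exactly `p^M`
(`p^{M-1} e u w = 0` would make `e (p^{M-1} u) = 0`). The abstract form of *"the Tate pairing
gives a perfect duality between the cyclic groups … of order `p^M`"* (McCallum 1991,
Lemma 5.3). [cite: McCallumLMS1991, §5 Lemma 5.3] -/
theorem addOrderOf_pairing_eq (hp : p.Prime) (hM : 1 ≤ M) (hT : ∀ t : T, p ^ M • t = 0)
    {A : Type*} [AddCommGroup A] (e : T →+ T →+ A) (halt : ∀ x, e x x = 0)
    (hnd : ∀ x, (∀ y, e x y = 0) → x = 0)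
    {u w : T} (hgen : ∀ z : T, ∃ β δ : ℤ, z = β • u + δ • w) (hu : p ^ (M - 1) • u ≠ 0) :
    addOrderOf (e u w) = p ^ M := by
  haveI : Fact p.Prime := ⟨hp⟩
  obtain ⟨n, hn⟩ : ∃ n, M = n + 1 := ⟨M - 1, by omega⟩
  subst hn
  rw [Nat.add_sub_cancel] at hu
  refine addOrderOf_eq_prime_pow (fun h0 ↦ hu (hnd _ fun y ↦ ?_)) ?_
  · obtain ⟨β, δ, rfl⟩ := hgen y
    rw [map_add, map_zsmul, map_zsmul, ← natCast_zsmul, pairing_zsmul_left, natCast_zsmul,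
      natCast_zsmul, halt u, smul_zero, smul_zero, zero_add, ← natCast_zsmul,
      pairing_zsmul_left, natCast_zsmul, h0, smul_zero]
  · rw [← natCast_zsmul, ← pairing_zsmul_left, natCast_zsmul, hT u, map_zero,
      AddMonoidHom.zero_apply]

/-- **McCallum 1991, Lemma 5.3, as the descent uses it (abstract form).** Let `T` be killed by
`p^M`, `e` biadditive, `x ∈ ℤu`, `y₀ ∈ ℤw` with `e u w` of order `p^M` (perfectness between the
cyclic eigen-parts `ℤu = T^ν ∋ x`, the Frobenius value of a Selmer eigenclass, and `ℤw = T^{-ν} ∋ y₀`,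
a tame value of the ramified class `d`). If `p^a y₀ ≠ 0` (*"`ord d_λ > p^a`"*) and `e x y₀ = 0`
(the global input `⟨s_λ, d_λ⟩ = 0`), then `p^{M-1-a} x = 0` (*"`p^{M-1-a} s_λ = 0`"*): writing
`x = α u`, `y₀ = γ w`, `p^M ∣ αγ` and `p^M ∤ p^a γ`, so `p^{a+1} ∣ α`.
[cite: McCallumLMS1991, §5 Lemma 5.3 (with Prop. 2.2)] -/
theorem pow_nsmul_eq_zero_of_pairing_eq_zero (hp : p.Prime) (hT : ∀ t : T, p ^ M • t = 0)
    {A : Type*} [AddCommGroup A] (e : T →+ T →+ A) {u w x y₀ : T}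
    (hx : x ∈ AddSubgroup.zmultiples u) (hy₀ : y₀ ∈ AddSubgroup.zmultiples w)
    (hω : addOrderOf (e u w) = p ^ M) {a : ℕ} (ha : p ^ a • y₀ ≠ 0) (he : e x y₀ = 0) :
    p ^ (M - 1 - a) • x = 0 := by
  haveI : Fact p.Prime := ⟨hp⟩
  obtain ⟨α, rfl⟩ := AddSubgroup.mem_zmultiples_iff.mp hx
  obtain ⟨γ, rfl⟩ := AddSubgroup.mem_zmultiples_iff.mp hy₀
  -- `p^M ∣ α γ`
  have h1 : (α * γ) • e u w = 0 := by
    rw [mul_comm, mul_smul, ← pairing_zsmul_left, ← map_zsmul]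
    exact he
  have hdvd : ((p ^ M : ℕ) : ℤ) ∣ α * γ := by
    rw [← hω]
    exact (addOrderOf_dvd_iff_zsmul_eq_zero).mpr h1
  -- `p^M ∤ p^a γ`
  have hγ0 : γ ≠ 0 := by
    rintro rfl
    exact ha (by rw [zero_smul, smul_zero])
  have hndvd : ¬ ((p ^ M : ℕ) : ℤ) ∣ (p : ℤ) ^ a * γ := by
    rintro ⟨k, hk⟩
    apply ha
    rw [← natCast_zsmul, smul_smul, Nat.cast_pow, hk, mul_comm, mul_smul, natCast_zsmul, hT,
      smul_zero]
  -- valuations: `v(α) + v(γ) ≥ M`, `a + v(γ) < M`, so `p^{a+1} ∣ α`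
  by_cases hα0 : α = 0
  · rw [hα0, zero_smul, smul_zero]
  rw [Nat.cast_pow, padicValInt_dvd_iff] at hdvd hndvd
  rcases hdvd with h0 | hM
  · exact absurd h0 (mul_ne_zero hα0 hγ0)
  rw [padicValInt.mul hα0 hγ0] at hM
  have hpa0 : (p : ℤ) ^ a ≠ 0 := pow_ne_zero _ (by exact_mod_cast hp.ne_zero)
  push Not at hndvd
  obtain ⟨-, hlt⟩ := hndvd
  have hva : padicValInt p ((p : ℤ) ^ a) = a := by
    rw [← Nat.cast_pow, padicValInt.of_nat, padicValNat.prime_pow]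
  rw [padicValInt.mul hpa0 hγ0, hva] at hlt
  obtain ⟨α', rfl⟩ : (p : ℤ) ^ (a + 1) ∣ α :=
    (padicValInt_dvd_iff (a + 1) α).mpr (Or.inr (by omega))
  rw [← natCast_zsmul, smul_smul]
  have hprod : ((p ^ (M - 1 - a) : ℕ) : ℤ) * ((p : ℤ) ^ (a + 1) * α') =
      α' * ((p ^ M : ℕ) : ℤ) := by
    rw [Nat.cast_pow, Nat.cast_pow, ← mul_assoc, ← pow_add,
      show M - 1 - a + (a + 1) = M by omega, mul_comm]
  rw [hprod, mul_smul, natCast_zsmul, hT u, smul_zero]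

/-! ## Generators of the two eigen-parts of `E_{p^M}` (McCallum: "cyclic groups of order `p^M`") -/

/-- Arithmetic: `a b ≤ p^M` with `a · b = p^{2M}` forces `a = p^M`. [folklore] -/
theorem eq_pow_of_mul_eq_pow_two_mul (hp : 0 < p) {a b : ℕ} (ha : a ≤ p ^ M) (hb : b ≤ p ^ M)
    (hab : a * b = p ^ (2 * M)) : a = p ^ M := by
  by_contra hne
  have hlt : a < p ^ M := lt_of_le_of_ne ha hne
  have : a * b < p ^ M * p ^ M :=
    calc a * b ≤ a * p ^ M := Nat.mul_le_mul_left a hb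
      _ < p ^ M * p ^ M := Nat.mul_lt_mul_of_lt_of_le hlt le_rfl (pow_pos hp M)
  rw [hab, two_mul, pow_add] at this
  exact lt_irrefl _ this

/-- **Generators of the eigen-parts.** Let `T` be finite abelian, killed by `p^M` (`p` odd),
of order `p^{2M}` with `p`-torsion of order `p²` (`T = E_{p^M}`, `T[p] = E_p`), and
`ι` an additive involution of `T` having non-zero `p`-torsion eigenvectors of both signs (complex
conjugation; Gross 1991, Prop. 9.5 / McCallum §3). Then both eigen-parts are **cyclic of order
`p^M`**: there are `u` (`ι u = u`) and `w` (`ι w = -w`) of order `p^M` with `T^+ = ℤu`,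
`T^- = ℤw`, `T = ℤu + ℤw` — McCallum 1991, Lemma 5.3 (*"cyclic groups of order `p^M`"*, proved
*"as in [1], Proposition 8.1"*): `#T = #T⁺·#T⁻`, `#T[p] = #T⁺[p]·#T⁻[p]` with both factors
`≠ 1`, so `#T^±[p] = p` and `T^±` is cyclic (`isAddCyclic_of_card_torsion_le`), of order
`≤ p^M` each and product `p^{2M}`. [cite: McCallumLMS1991, §5 Lemma 5.3]
[cite: GrossLMS1991, Prop. 8.1 (1)] -/
theorem exists_eigen_generators [Finite T] (hp : p.Prime) (hp2 : p ≠ 2)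
    (hT : ∀ t : T, p ^ M • t = 0) (hcard : Nat.card T = p ^ (2 * M))
    (hcardp : Nat.card {x : T // p • x = 0} = p ^ 2)
    (ι : T →+ T) (hι : ∀ x, ι (ι x) = x)
    {v₁ v₂ : T} (hv₁0 : v₁ ≠ 0) (hv₁p : p • v₁ = 0) (hv₁ : ι v₁ = v₁)
    (hv₂0 : v₂ ≠ 0) (hv₂p : p • v₂ = 0) (hv₂ : ι v₂ = -v₂) :
    ∃ u w : T, ι u = u ∧ ι w = -w ∧ (∀ x, ι x = x → x ∈ AddSubgroup.zmultiples u) ∧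
      (∀ x, ι x = -x → x ∈ AddSubgroup.zmultiples w) ∧
      (∀ z, ∃ β δ : ℤ, z = β • u + δ • w) ∧ addOrderOf u = p ^ M ∧ addOrderOf w = p ^ M := by
  classical
  haveI : Fact p.Prime := ⟨hp⟩
  -- the eigen-parts `P = T⁺`, `Q = T⁻` and the `p`-torsion `S = T[p]` as subgroups
  set P : AddSubgroup T := (ι - AddMonoidHom.id T).ker with hPdef
  set Q : AddSubgroup T := (ι + AddMonoidHom.id T).ker with hQdef
  set S : AddSubgroup T := (DistribSMul.toAddMonoidHom T p).ker with hSdef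
  have hmemP : ∀ x, x ∈ P ↔ ι x = x := fun x ↦ by
    rw [hPdef, AddMonoidHom.mem_ker, AddMonoidHom.sub_apply, AddMonoidHom.id_apply, sub_eq_zero]
  have hmemQ : ∀ x, x ∈ Q ↔ ι x = -x := fun x ↦ by
    rw [hQdef, AddMonoidHom.mem_ker, AddMonoidHom.add_apply, AddMonoidHom.id_apply,
      add_eq_zero_iff_eq_neg]
  have hmemS : ∀ x, x ∈ S ↔ p • x = 0 := fun x ↦ by
    rw [hSdef, AddMonoidHom.mem_ker, DistribSMul.toAddMonoidHom_apply]
  have hSι : ∀ x ∈ S, ι x ∈ S := fun x hx ↦ by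
    rw [hmemS] at hx ⊢
    rw [← map_nsmul, hx, map_zero]
  -- `#T = #P · #Q`
  have h1 := card_eq_card_mul_card hp hp2 hT ι hι ⊤ (fun x _ ↦ AddSubgroup.mem_top _)
  rw [AddSubgroup.card_top, hcard] at h1
  have hPcard : Nat.card P = Nat.card {x : T // x ∈ (⊤ : AddSubgroup T) ∧ ι x = x} :=
    Nat.card_congr (Equiv.subtypeEquivRight fun x ↦ by
      rw [hmemP]; exact (iff_of_eq (true_and _).symm).trans (and_congr_left' Iff.rfl))
  have hQcard : Nat.card Q = Nat.card {x : T // x ∈ (⊤ : AddSubgroup T) ∧ ι x = -x} :=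
    Nat.card_congr (Equiv.subtypeEquivRight fun x ↦ by
      rw [hmemQ]; exact (iff_of_eq (true_and _).symm).trans (and_congr_left' Iff.rfl))
  rw [← hPcard, ← hQcard] at h1
  -- `#S = #(S ⊓ P) · #(S ⊓ Q) = p²`
  have h2 := card_eq_card_mul_card hp hp2 hT ι hι S hSι
  have hScard : Nat.card S = p ^ 2 := by
    rw [← hcardp]
    exact Nat.card_congr (Equiv.subtypeEquivRight fun x ↦ hmemS x)
  rw [hScard] at h2
  have hSPcard : Nat.card (S ⊓ P : AddSubgroup T) = Nat.card {x : T // x ∈ S ∧ ι x = x} :=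
    Nat.card_congr (Equiv.subtypeEquivRight fun x ↦ by
      rw [AddSubgroup.mem_inf, hmemP])
  have hSQcard : Nat.card (S ⊓ Q : AddSubgroup T) = Nat.card {x : T // x ∈ S ∧ ι x = -x} :=
    Nat.card_congr (Equiv.subtypeEquivRight fun x ↦ by
      rw [AddSubgroup.mem_inf, hmemQ])
  rw [← hSPcard, ← hSQcard] at h2
  -- both factors divide `p²` and are `≠ 1`, hence `= p`
  have hSfin : Nat.card S ≠ 0 := by rw [hScard]; exact pow_ne_zero 2 hp.ne_zero
  haveI : Finite S := Nat.finite_of_card_ne_zero hSfin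
  have hdvP : Nat.card (S ⊓ P : AddSubgroup T) ∣ p ^ 2 :=
    hScard ▸ AddSubgroup.card_dvd_of_le inf_le_left
  have hdvQ : Nat.card (S ⊓ Q : AddSubgroup T) ∣ p ^ 2 :=
    hScard ▸ AddSubgroup.card_dvd_of_le inf_le_left
  have hne1 : ∀ {H : AddSubgroup T} {v : T}, v ∈ H → v ≠ 0 → Nat.card H ≠ 1 := by
    intro H v hv hv0 hc
    haveI := (Nat.card_eq_one_iff_unique.mp hc).1
    exact hv0 (congrArg Subtype.val (Subsingleton.elim (⟨v, hv⟩ : H) ⟨0, H.zero_mem⟩))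
  have hv₁SP : v₁ ∈ (S ⊓ P : AddSubgroup T) :=
    AddSubgroup.mem_inf.mpr ⟨(hmemS _).mpr hv₁p, (hmemP _).mpr hv₁⟩
  have hv₂SQ : v₂ ∈ (S ⊓ Q : AddSubgroup T) :=
    AddSubgroup.mem_inf.mpr ⟨(hmemS _).mpr hv₂p, (hmemQ _).mpr hv₂⟩
  obtain ⟨i, hi2, hi⟩ := (Nat.dvd_prime_pow hp).mp hdvP
  obtain ⟨j, hj2, hj⟩ := (Nat.dvd_prime_pow hp).mp hdvQ
  have hi0 : i ≠ 0 := fun h0 ↦ hne1 hv₁SP hv₁0 (by rw [hi, h0, pow_zero])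
  have hj0 : j ≠ 0 := fun h0 ↦ hne1 hv₂SQ hv₂0 (by rw [hj, h0, pow_zero])
  have hij : i + j = 2 := by
    rw [hi, hj, ← pow_add] at h2
    exact (Nat.pow_right_injective hp.two_le h2).symm
  have hi1 : i = 1 := by omega
  have hj1 : j = 1 := by omega
  rw [hi1, pow_one] at hi
  rw [hj1, pow_one] at hj
  -- `P`, `Q` are cyclic
  have hcycP : IsAddCyclic P := by
    refine isAddCyclic_of_card_torsion_le (M := M) hp (fun g ↦ Subtype.ext ?_) (le_of_eq ?_)
    · rw [AddSubgroupClass.coe_nsmul, ZeroMemClass.coe_zero]; exact hT _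
    · refine Eq.trans (Nat.card_congr ?_) hi
      exact
        { toFun := fun g ↦ ⟨g.1.1, AddSubgroup.mem_inf.mpr ⟨(hmemS _).mpr (by
            have := congrArg Subtype.val g.2
            rwa [AddSubgroupClass.coe_nsmul, ZeroMemClass.coe_zero] at this), g.1.2⟩⟩
          invFun := fun x ↦ ⟨⟨x.1, (AddSubgroup.mem_inf.mp x.2).2⟩, Subtype.ext (by
            rw [AddSubgroupClass.coe_nsmul, ZeroMemClass.coe_zero]
            exact (hmemS _).mp (AddSubgroup.mem_inf.mp x.2).1)⟩
          left_inv := fun g ↦ rfl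
          right_inv := fun x ↦ rfl }
  have hcycQ : IsAddCyclic Q := by
    refine isAddCyclic_of_card_torsion_le (M := M) hp (fun g ↦ Subtype.ext ?_) (le_of_eq ?_)
    · rw [AddSubgroupClass.coe_nsmul, ZeroMemClass.coe_zero]; exact hT _
    · refine Eq.trans (Nat.card_congr ?_) hj
      exact
        { toFun := fun g ↦ ⟨g.1.1, AddSubgroup.mem_inf.mpr ⟨(hmemS _).mpr (by
            have := congrArg Subtype.val g.2
            rwa [AddSubgroupClass.coe_nsmul, ZeroMemClass.coe_zero] at this), g.1.2⟩⟩
          invFun := fun x ↦ ⟨⟨x.1, (AddSubgroup.mem_inf.mp x.2).2⟩, Subtype.ext (by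
            rw [AddSubgroupClass.coe_nsmul, ZeroMemClass.coe_zero]
            exact (hmemS _).mp (AddSubgroup.mem_inf.mp x.2).1)⟩
          left_inv := fun g ↦ rfl
          right_inv := fun x ↦ rfl }
  obtain ⟨gP, hgP⟩ := hcycP.exists_zsmul_surjective
  obtain ⟨gQ, hgQ⟩ := hcycQ.exists_zsmul_surjective
  set u : T := gP.1 with hu
  set w : T := gQ.1 with hw
  have hPu : ∀ x, ι x = x → x ∈ AddSubgroup.zmultiples u := fun x hx ↦ by
    obtain ⟨k, hk⟩ := hgP ⟨x, (hmemP x).mpr hx⟩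
    exact AddSubgroup.mem_zmultiples_iff.mpr ⟨k, by
      have := congrArg Subtype.val hk
      rwa [AddSubgroupClass.coe_zsmul] at this⟩
  have hQw : ∀ x, ι x = -x → x ∈ AddSubgroup.zmultiples w := fun x hx ↦ by
    obtain ⟨k, hk⟩ := hgQ ⟨x, (hmemQ x).mpr hx⟩
    exact AddSubgroup.mem_zmultiples_iff.mpr ⟨k, by
      have := congrArg Subtype.val hk
      rwa [AddSubgroupClass.coe_zsmul] at this⟩
  -- orders: `#P = ord u ≤ p^M`, `#Q = ord w ≤ p^M`, product `p^{2M}`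
  have hPeq : P = AddSubgroup.zmultiples u :=
    le_antisymm (fun x hx ↦ hPu x ((hmemP x).mp hx)) (AddSubgroup.zmultiples_le.mpr gP.2)
  have hQeq : Q = AddSubgroup.zmultiples w :=
    le_antisymm (fun x hx ↦ hQw x ((hmemQ x).mp hx)) (AddSubgroup.zmultiples_le.mpr gQ.2)
  have hordu : addOrderOf u ∣ p ^ M := addOrderOf_dvd_of_nsmul_eq_zero (hT u)
  have hordw : addOrderOf w ∣ p ^ M := addOrderOf_dvd_of_nsmul_eq_zero (hT w)
  have hcPu : Nat.card P = addOrderOf u := by rw [hPeq, Nat.card_zmultiples]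
  have hcQw : Nat.card Q = addOrderOf w := by rw [hQeq, Nat.card_zmultiples]
  rw [hcPu, hcQw] at h1
  have hppos : 0 < p ^ M := pow_pos hp.pos M
  have hou : addOrderOf u = p ^ M :=
    eq_pow_of_mul_eq_pow_two_mul hp.pos (Nat.le_of_dvd hppos hordu) (Nat.le_of_dvd hppos hordw)
      h1.symm
  have how : addOrderOf w = p ^ M :=
    eq_pow_of_mul_eq_pow_two_mul hp.pos (Nat.le_of_dvd hppos hordw) (Nat.le_of_dvd hppos hordu)
      (by rw [mul_comm]; exact h1.symm)
  refine ⟨u, w, (hmemP u).mp gP.2, (hmemQ w).mp gQ.2, hPu, hQw, fun z ↦ ?_, hou, how⟩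
  obtain ⟨a, b, ha, hb, rfl⟩ := exists_eigen_add_eigen hp hp2 hT ι hι z
  obtain ⟨β, hβ⟩ := AddSubgroup.mem_zmultiples_iff.mp (hPu a ha)
  obtain ⟨δ, hδ⟩ := AddSubgroup.mem_zmultiples_iff.mp (hQw b hb)
  exact ⟨β, δ, by rw [hβ, hδ]⟩

/-- An element of order `p^M` (`M ≥ 1`) is not killed by `p^{M-1}`. [folklore] -/
theorem pow_pred_nsmul_ne_zero (hp : p.Prime) (hM : 1 ≤ M) {u : T}
    (hu : addOrderOf u = p ^ M) : p ^ (M - 1) • u ≠ 0 := by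
  intro h0
  have hdvd := addOrderOf_dvd_of_nsmul_eq_zero h0
  rw [hu] at hdvd
  have := Nat.le_of_dvd (pow_pos hp.pos _) hdvd
  have hlt : p ^ (M - 1) < p ^ M := Nat.pow_lt_pow_right hp.one_lt (by omega)
  omega

end KolyvaginEigenPow

end Literature.NumberTheory.EllipticCurves
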